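import Summits.BirchSwinnertonDyer.BirchSwinnertonDyer.Theorems.Rank2Observatory2DescKillSig12
import Summits.BirchSwinnertonDyer.BirchSwinnertonDyer.Theorems.ShaPrimaryTransferFiniteShaComponentTransferSelmerCubicKillCertMod
import HarnessLib

/-!
# BirchSwinnertonDyer — SEL2CUBIC kill layer: the certificate `sig12uCheck` in RESIDUE form

HONEST FRAMING: route `ShaPrimaryTransfer`, seat `bsd-line-spt-p1` (g30), `--supports` item T =
`FiniteShaComponentTransfer` (stmt-22356), UNCHANGED (conjecture-grade at corank ≥ 2). BSD in rank ≥ 2 is NOT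
proved by any of this. THEOREMS ONLY.

As `…SelmerCubicKillCertMod` (there: `killCheck`, `sig3Check`), for the TIER 2u signature certificate at an odd
prime with one `ℤ_q`-root and an UNRAMIFIED quadratic place (`Rank2Observatory2DescKillSig12`): the landed
`sig12uCore_sound` / `sig12uCheck_sound` read with the exact integer zero of `killQ` replaced by the congruence
`q^N ∣ Q₁(v), Q₂(v)` — the statement a `2`-Selmer class contradicts (`…SelmerCubicKillLocal`). The proofs are the
tree's verbatim; only the two root relations change (`root_rel_mod` of `…KillCertMod`, and `quad_rel_mod` here,
the quadratic-place relation `quad_rel` under the congruence hypothesis).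
[cite: Cassels1991LecturesEllipticCurves, §15] [cite: CremonaAlgorithms1997, §3.6]
-/

-- single-conjunct summit: `Summit.BirchSwinnertonDyer.BirchSwinnertonDyer.…` repeats the name by design
set_option linter.dupNamespace false

namespace Summit.BirchSwinnertonDyer.BirchSwinnertonDyer.Theorems.ShaPrimaryTransferSelmerCubicKill

open Summit.BirchSwinnertonDyer.BirchSwinnertonDyer.Rank2Observatory
open Summit.BirchSwinnertonDyer.BirchSwinnertonDyer.Rank2Observatory.TwoDescKill

/-- **Evaluation at the quadratic place mod `M`, residue form**: as `quad_rel`, assuming only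
`M ∣ Q₁(x₀, x₁, x₂, n)` and `M ∣ Q₂(x₀, x₁, x₂, n)`. [cite: Cassels1991LecturesEllipticCurves, §15] -/
theorem quad_rel_mod {M : ℕ} [NeZero M] {a b c ε r₁ m dl : ℤ}
    (ha : (a : ZMod M) = -(ε : ZMod M) - 2 * (r₁ : ZMod M))
    (hb : (b : ZMod M) = (r₁ : ZMod M) * r₁ - (m : ZMod M) * m * dl + 2 * (ε : ZMod M) * r₁)
    (hc : (c : ZMod M) = -((ε : ZMod M) * ((r₁ : ZMod M) * r₁ - (m : ZMod M) * m * dl)))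
    {z : ℤ × ℤ × ℤ} {t₁ t₂ x₀ x₁ x₂ n : ℤ}
    (h0 : (M : ℤ) ∣ (killQ a b c z t₁ t₂ (x₀, x₁, x₂, n)).1 ∧ (M : ℤ) ∣ (killQ a b c z t₁ t₂ (x₀, x₁, x₂, n)).2) :
    (M : ℤ) ∣ (pmul dl ((ev2 r₁ m dl z).1 % (M : ℤ), (ev2 r₁ m dl z).2 % (M : ℤ))
        (pmul dl (ev2 r₁ m dl (x₀, x₁, x₂)) (ev2 r₁ m dl (x₀, x₁, x₂)))).1 -
      ((zsq a b c z (x₀, x₁, x₂)).1 - n ^ 2 * ((ev2 r₁ m dl ((0 : ℤ), t₁, t₂)).1 % (M : ℤ))) ∧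
    (M : ℤ) ∣ (pmul dl ((ev2 r₁ m dl z).1 % (M : ℤ), (ev2 r₁ m dl z).2 % (M : ℤ))
        (pmul dl (ev2 r₁ m dl (x₀, x₁, x₂)) (ev2 r₁ m dl (x₀, x₁, x₂)))).2 -
      (-(n ^ 2 * ((ev2 r₁ m dl ((0 : ℤ), t₁, t₂)).2 % (M : ℤ)))) := by
  have hQ1 : (M : ℤ) ∣ (zsq a b c z (x₀, x₁, x₂)).2.1 + t₁ * n ^ 2 := by
    have := h0.1; simpa only [killQ] using this
  have hQ2 : (M : ℤ) ∣ (zsq a b c z (x₀, x₁, x₂)).2.2 + t₂ * n ^ 2 := by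
    have := h0.2; simpa only [killQ] using this
  have hQ1' : ((zsq a b c z (x₀, x₁, x₂)).2.1 : ZMod M) + (t₁ : ZMod M) * (n : ZMod M) ^ 2 = 0 := by
    have := (ZMod.intCast_zmod_eq_zero_iff_dvd _ M).mpr hQ1
    push_cast at this
    exact this
  have hQ2' : ((zsq a b c z (x₀, x₁, x₂)).2.2 : ZMod M) + (t₂ : ZMod M) * (n : ZMod M) ^ 2 = 0 := by
    have := (ZMod.intCast_zmod_eq_zero_iff_dvd _ M).mpr hQ2
    push_cast at this
    exact this
  have hmap := map_zsq (Int.castRingHom (ZMod M)) a b c z (x₀, x₁, x₂)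
  simp only [eq_intCast] at hmap
  rw [ha, hb, hc] at hmap
  have hev := ev2_zsq (ε : ZMod M) (r₁ : ZMod M) (m : ZMod M) (dl : ZMod M)
    ((z.1 : ZMod M), (z.2.1 : ZMod M), (z.2.2 : ZMod M)) ((x₀ : ZMod M), (x₁ : ZMod M), (x₂ : ZMod M))
  rw [← hmap] at hev
  have c1 := congrArg Prod.fst hev
  have c2 := congrArg Prod.snd hev
  simp only [ev2, pmulR] at c1 c2
  constructor
  · apply (ZMod.intCast_zmod_eq_zero_iff_dvd _ M).mp
    simp only [pmul, ev2]
    push_cast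
    linear_combination (-1 : ZMod M) * c1 + (r₁ : ZMod M) * hQ1' +
      ((r₁ : ZMod M) * r₁ + (m : ZMod M) * m * dl) * hQ2'
  · apply (ZMod.intCast_zmod_eq_zero_iff_dvd _ M).mp
    simp only [pmul, ev2]
    push_cast
    linear_combination (-1 : ZMod M) * c2 + (m : ZMod M) * hQ1' + 2 * (m : ZMod M) * r₁ * hQ2'

/-- **Soundness of `sig12uCore`, residue form**: on data linked to the curve as in `sig12uCore_sound`, no integer
vector primitive at `q` has `q^N ∣ Q₁` and `q^N ∣ Q₂` (the tree's proof verbatim with `root_rel_mod`,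
`quad_rel_mod`). [cite: Cassels1991LecturesEllipticCurves, §15] [cite: CremonaAlgorithms1997, §3.6] -/
theorem sig12uCore_sound_mod {q : ℕ} (hq : q.Prime) {a b c : ℤ} {z : ℤ × ℤ × ℤ} {t₁ t₂ : ℤ} {N : ℕ}
    {ε h₁ h₀ r₁ Dp dl : ℤ} {kd : ℕ} {ρ : ℤ × ℕ × ℤ} {ZC ZB : ℤ} {s₂ : ℕ} {UC UB EC EB : ℤ} {k : ℕ} {Bu : ℤ}
    (h : sig12uCore q N c ε h₁ h₀ r₁ Dp dl kd ρ ZC ZB s₂ UC UB EC EB k Bu = true)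
    (hh₁ : h₁ = (a + ε) % ((q ^ N : ℕ) : ℤ)) (hh₀ : h₀ = (b + ε * h₁) % ((q ^ N : ℕ) : ℤ))
    (hDp : Dp = (r₁ * r₁ - h₀) % ((q ^ N : ℕ) : ℤ)) (hρ : ρ = rootData q N z t₁ t₂ ε)
    (hZC : ZC = (ev2 r₁ ((q ^ kd : ℕ) : ℤ) dl z).1 % ((q ^ N : ℕ) : ℤ))
    (hZB : ZB = (ev2 r₁ ((q ^ kd : ℕ) : ℤ) dl z).2 % ((q ^ N : ℕ) : ℤ))
    (hEC : EC = (ev2 r₁ ((q ^ kd : ℕ) : ℤ) dl ((0 : ℤ), t₁, t₂)).1 % ((q ^ N : ℕ) : ℤ))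
    (hEB : EB = (ev2 r₁ ((q ^ kd : ℕ) : ℤ) dl ((0 : ℤ), t₁, t₂)).2 % ((q ^ N : ℕ) : ℤ))
    (v : ℤ × ℤ × ℤ × ℤ) (hprim : ¬ ((q : ℤ) ∣ v.1 ∧ (q : ℤ) ∣ v.2.1 ∧ (q : ℤ) ∣ v.2.2.1 ∧ (q : ℤ) ∣ v.2.2.2))
    (h0 : (q : ℤ) ^ N ∣ (killQ a b c z t₁ t₂ v).1 ∧ (q : ℤ) ^ N ∣ (killQ a b c z t₁ t₂ v).2) :
    False := by
  obtain ⟨x₀, x₁, x₂, n⟩ := v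
  have hpZ : Prime (q : ℤ) := Nat.prime_iff_prime_int.mp hq
  have hq0 : (q : ℤ) ≠ 0 := by exact_mod_cast hq.ne_zero
  haveI : NeZero (q ^ N) := ⟨pow_ne_zero _ hq.ne_zero⟩
  have hMZ : ((q ^ N : ℕ) : ℤ) = (q : ℤ) ^ N := Nat.cast_pow q N
  simp only [sig12uCore, Bool.and_eq_true, Bool.not_eq_true', decide_eq_true_eq,
    decide_eq_false_iff_not, unitOK] at h
  obtain ⟨⟨⟨⟨⟨⟨⟨⟨⟨⟨⟨⟨⟨⟨-, hC2⟩, hC3⟩, hC4⟩, hC5⟩, hC6⟩, hC7⟩, hC8⟩, hC10⟩, hC11⟩, hC12⟩, hC13⟩,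
    hC14⟩, hC15⟩, hwalk⟩ := h
  -- units
  have hdl : ¬ (q : ℤ) ∣ dl := fun hd => hC5 (Int.emod_eq_zero_of_dvd hd)
  have hhε : ¬ (q : ℤ) ∣ (ε - r₁) ^ 2 - Dp := fun hd => hC7 (Int.emod_eq_zero_of_dvd hd)
  have hu₁ : ¬ (q : ℤ) ∣ ρ.2.2 := fun hd => hC8 (Int.emod_eq_zero_of_dvd hd)
  have hUn : ¬ (q : ℤ) ∣ nm dl (UC, UB).1 (UC, UB).2 := fun hd => hC12 (Int.emod_eq_zero_of_dvd hd)
  have hBu : ¬ (q : ℤ) ∣ Bu := fun hd => hC14 (Int.emod_eq_zero_of_dvd hd)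
  have hBp : (q : ℤ) ∣ Bu - Bu % (q : ℤ) := (Int.mod_modEq _ _).dvd
  have hrat : ¬ (ρ.2.1 % 2 = s₂ % 2 ∧ eulerBit q (nm dl (UC, UB).1 (UC, UB).2) = true) := by
    rintro ⟨e1, e2⟩
    simp [e1, e2] at hC15
  rw [Nat.cast_pow] at hC4 hC10 hC11 hC13
  have hguard : 0 + (max ρ.2.1 s₂ + 2 * kd) < N := walk2_guard hwalk
  have hS1 : ρ.2.1 ≤ max ρ.2.1 s₂ := le_max_left _ _
  have hS2 : s₂ ≤ max ρ.2.1 s₂ := le_max_right _ _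
  -- `D' = m·m·δ` with `m = q^{k_d}`
  have E5Z : Dp = ((q ^ kd : ℕ) : ℤ) * ((q ^ kd : ℕ) : ℤ) * dl := by
    rw [hC4, Nat.cast_pow, two_mul, pow_add]
  -- the coefficient identities in `ZMod (q^N)`
  have E1 : (h₁ : ZMod (q ^ N)) = (a : ZMod (q ^ N)) + ε := by
    rw [hh₁, ZMod.intCast_mod]; push_cast; ring
  have E3 : (h₀ : ZMod (q ^ N)) = (b : ZMod (q ^ N)) + ε * h₁ := by
    rw [hh₀, ZMod.intCast_mod]; push_cast; ring
  have E4 : (Dp : ZMod (q ^ N)) = (r₁ : ZMod (q ^ N)) * r₁ - h₀ := by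
    rw [hDp, ZMod.intCast_mod]; push_cast; ring
  have E5 : (Dp : ZMod (q ^ N)) = (((q ^ kd : ℕ) : ℤ) : ZMod (q ^ N)) * ((q ^ kd : ℕ) : ℤ) * dl := by
    rw [E5Z]; push_cast; ring
  have E2 : 2 * (r₁ : ZMod (q ^ N)) + h₁ = 0 := by
    have := (ZMod.intCast_zmod_eq_zero_iff_dvd _ (q ^ N)).mpr (Int.dvd_of_emod_eq_zero hC3)
    push_cast at this
    exact this
  have E6 : (c : ZMod (q ^ N)) + ε * h₀ = 0 := by
    have := (ZMod.intCast_zmod_eq_zero_iff_dvd _ (q ^ N)).mpr (Int.dvd_of_emod_eq_zero hC2)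
    push_cast at this
    exact this
  have ha' : (a : ZMod (q ^ N)) = -(ε : ZMod (q ^ N)) - 2 * (r₁ : ZMod (q ^ N)) := by
    linear_combination -E1 + E2
  have hb' : (b : ZMod (q ^ N)) = (r₁ : ZMod (q ^ N)) * r₁ -
      (((q ^ kd : ℕ) : ℤ) : ZMod (q ^ N)) * ((q ^ kd : ℕ) : ℤ) * dl + 2 * (ε : ZMod (q ^ N)) * r₁ := by
    linear_combination -E3 + E4 - E5 - (ε : ZMod (q ^ N)) * E2
  have hc' : (c : ZMod (q ^ N)) = -((ε : ZMod (q ^ N)) * ((r₁ : ZMod (q ^ N)) * r₁ -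
      (((q ^ kd : ℕ) : ℤ) : ZMod (q ^ N)) * ((q ^ kd : ℕ) : ℤ) * dl)) := by
    linear_combination E6 - (ε : ZMod (q ^ N)) * E4 + (ε : ZMod (q ^ N)) * E5
  have hg : (ε ^ 3 + a * ε ^ 2 + b * ε + c) % ((q ^ N : ℕ) : ℤ) = 0 := by
    apply Int.emod_eq_zero_of_dvd
    apply (ZMod.intCast_zmod_eq_zero_iff_dvd _ (q ^ N)).mp
    push_cast
    linear_combination E6 - (ε : ZMod (q ^ N)) * E3 - (ε : ZMod (q ^ N)) ^ 2 * E1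
  -- the root relation
  have REL1 : (q : ℤ) ^ N ∣ (q : ℤ) ^ ρ.2.1 * ρ.2.2 * (x₀ + x₁ * ε + x₂ * ε ^ 2) ^ 2 -
      ((zsq a b c z (x₀, x₁, x₂)).1 - n ^ 2 * ρ.1) := by
    have h1 := root_rel_mod hg h0
    have h2 := splitPow_spec q N ((z.1 + z.2.1 * ε + z.2.2 * ε ^ 2) % ((q ^ N : ℕ) : ℤ))
    rw [hρ]
    simp only [rootData]
    rw [← h2]
    exact h1
  -- the pair relation
  set P : ℤ × ℤ := ev2 r₁ ((q ^ kd : ℕ) : ℤ) dl (x₀, x₁, x₂) with hP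
  obtain ⟨REL2a, REL2b⟩ := quad_rel_mod (M := q ^ N) ha' hb' hc' (by push_cast; exact h0)
  rw [← hZC, ← hZB, ← hEC, hMZ] at REL2a
  rw [← hZC, ← hZB, ← hEB, hMZ] at REL2b
  have eA1 : (pmul dl (ZC, ZB) (pmul dl P P)).1 = (q : ℤ) ^ s₂ * (pmul dl (UC, UB) (pmul dl P P)).1 := by
    simp only [pmul, hC10, hC11]; ring
  have eA2 : (pmul dl (ZC, ZB) (pmul dl P P)).2 = (q : ℤ) ^ s₂ * (pmul dl (UC, UB) (pmul dl P P)).2 := by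
    simp only [pmul, hC10, hC11]; ring
  rw [eA1] at REL2a
  rw [eA2, hC13] at REL2b
  generalize hw₀ : (zsq a b c z (x₀, x₁, x₂)).1 = w₀ at REL1 REL2a REL2b
  -- the components of `P = ev2 x`
  have hP1 : P.1 = x₀ + x₁ * r₁ + x₂ * (r₁ * r₁ + Dp) := by rw [hP, E5Z]; simp only [ev2]
  have hP2 : P.2 = ((q ^ kd : ℕ) : ℤ) * (x₁ + 2 * r₁ * x₂) := by rw [hP]; simp only [ev2]
  by_cases hn : (q : ℤ) ∣ n
  · -- `q ∣ n`: by the index lemma the root value is a unit or the pair value is not divisible by `q^{k_d+1}`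
    have tri : ¬ (q : ℤ) ∣ x₀ + x₁ * ε + x₂ * ε ^ 2 ∨
        ¬ ((q : ℤ) ^ (kd + 1) ∣ P.1 ∧ (q : ℤ) ^ (kd + 1) ∣ P.2) := by
      by_contra hcon
      push Not at hcon
      obtain ⟨hX, hPa, hPb⟩ := hcon
      have h2 : (q : ℤ) ∣ x₀ + x₁ * r₁ + x₂ * (r₁ * r₁ + Dp) := by
        rw [← hP1]; exact dvd_trans (dvd_pow_self _ (Nat.succ_ne_zero kd)) hPa
      have h3 : (q : ℤ) ∣ x₁ + 2 * r₁ * x₂ := by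
        rw [hP2, Nat.cast_pow, pow_succ] at hPb
        exact (mul_dvd_mul_iff_left (pow_ne_zero kd hq0)).mp hPb
      have hidx := index2 hq hhε hX h2 h3
      exact hprim ⟨hidx.1, hidx.2.1, hidx.2.2, hn⟩
    rcases tri with hX | hPnd
    · -- the root value is a unit
      obtain ⟨μ, P₁, hPμ, hP₁, hμ⟩ := val_bound hq hu₁ (D := 0) (R := x₀ + x₁ * ε + x₂ * ε ^ 2)
        (by simpa using hX) (by omega) REL1
      by_cases hcmp : (q : ℤ) ^ (μ + 1) ∣ n ^ 2
      · exact rat2 hq hdl hC6 hUn hu₁ (by omega) hP₁ hPμ hcmp hrat ⟨_, REL1⟩ ⟨P, REL2a, REL2b⟩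
      · have hn0 : n ≠ 0 := by
          rintro rfl
          exact hcmp (by simp)
        obtain ⟨τ, n', hn', hnd⟩ : ∃ (k : ℕ) (x' : ℤ), n = (q : ℤ) ^ k * x' ∧ ¬ (q : ℤ) ∣ x' :=
          ⟨_, (Int.finiteMultiplicity_iff.mpr ⟨by simpa using hq.one_lt.ne', hn0⟩).exists_eq_pow_mul_and_not_dvd⟩
        have h2τ : 2 * τ ≤ μ := by
          by_contra hlt
          push Not at hlt
          apply hcmp
          rw [hn', mul_pow, ← pow_mul]
          exact dvd_mul_of_dvd_left (pow_dvd_pow _ (by omega)) _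
        obtain ⟨i, hi⟩ : ∃ i, μ = 2 * τ + i := ⟨μ - 2 * τ, by omega⟩
        have hw₀' : w₀ = (q : ℤ) ^ (2 * τ) * ((q : ℤ) ^ i * P₁ + n' ^ 2 * ρ.1) := by
          have e := hPμ
          rw [hi, pow_add, hn', mul_pow, ← pow_mul, mul_comm τ 2] at e
          linear_combination e
        exact kill_scaled hq hu₁ hdl hC6 hUn hBu hBp (τ := τ) (by omega) hwalk hw₀' hn' hnd
          ⟨_, REL1⟩ ⟨P, REL2a, REL2b⟩
    · -- the pair value is not divisible by `q^{k_d+1}`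
      obtain ⟨μ, W', hW1, hW2, hWp, hμ⟩ := val_bound2 hq hdl hC6 hUn (D := kd)
        (W := (w₀ - n ^ 2 * EC, -(n ^ 2 * ((q : ℤ) ^ k * Bu)))) hPnd (by omega) REL2a REL2b
      dsimp only at hW1 hW2
      by_cases hcmp : (q : ℤ) ^ (μ + 1) ∣ n ^ 2
      · obtain ⟨tt, htt⟩ := hcmp
        have htt' : n ^ 2 = (q : ℤ) ^ μ * ((q : ℤ) * tt) := by rw [htt, pow_succ]; ring
        have hW'2 : (q : ℤ) ∣ W'.2 := by
          have e : (q : ℤ) ^ μ * W'.2 = (q : ℤ) ^ μ * (-((q : ℤ) * tt * ((q : ℤ) ^ k * Bu))) := by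
            rw [← hW2, htt']; ring
          rw [mul_left_cancel₀ (pow_ne_zero μ hq0) e]
          exact ⟨-(tt * ((q : ℤ) ^ k * Bu)), by ring⟩
        have hW'1 : ¬ (q : ℤ) ∣ W'.1 := fun hd => hWp ⟨hd, hW'2⟩
        have hPr : w₀ - n ^ 2 * ρ.1 = (q : ℤ) ^ μ * (W'.1 + (q : ℤ) * tt * (EC - ρ.1)) := by
          linear_combination hW1 + (EC - ρ.1) * htt'
        have hunit : ¬ (q : ℤ) ∣ W'.1 + (q : ℤ) * tt * (EC - ρ.1) := by
          intro hd
          apply hW'1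
          simpa using dvd_sub hd (⟨tt * (EC - ρ.1), by ring⟩ : (q : ℤ) ∣ (q : ℤ) * tt * (EC - ρ.1))
        exact rat2 hq hdl hC6 hUn hu₁ (by omega) hunit hPr ⟨tt, htt⟩ hrat ⟨_, REL1⟩ ⟨P, REL2a, REL2b⟩
      · have hn0 : n ≠ 0 := by
          rintro rfl
          exact hcmp (by simp)
        obtain ⟨τ, n', hn', hnd⟩ : ∃ (k : ℕ) (x' : ℤ), n = (q : ℤ) ^ k * x' ∧ ¬ (q : ℤ) ∣ x' :=
          ⟨_, (Int.finiteMultiplicity_iff.mpr ⟨by simpa using hq.one_lt.ne', hn0⟩).exists_eq_pow_mul_and_not_dvd⟩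
        have h2τ : 2 * τ ≤ μ := by
          by_contra hlt
          push Not at hlt
          apply hcmp
          rw [hn', mul_pow, ← pow_mul]
          exact dvd_mul_of_dvd_left (pow_dvd_pow _ (by omega)) _
        obtain ⟨i, hi⟩ : ∃ i, μ = 2 * τ + i := ⟨μ - 2 * τ, by omega⟩
        have hw₀' : w₀ = (q : ℤ) ^ (2 * τ) * ((q : ℤ) ^ i * W'.1 + n' ^ 2 * EC) := by
          have e := hW1
          rw [hi, pow_add, hn', mul_pow, ← pow_mul, mul_comm τ 2] at e
          linear_combination e
        exact kill_scaled hq hu₁ hdl hC6 hUn hBu hBp (τ := τ) (by omega) hwalk hw₀' hn' hnd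
          ⟨_, REL1⟩ ⟨P, REL2a, REL2b⟩
  · -- `q ∤ n`: the walk at offset `0` with `y = w₀/n²`
    exact kill_scaled hq hu₁ hdl hC6 hUn hBu hBp (τ := 0) (by omega) hwalk (y₀ := w₀) (n' := n)
      (by simp) (by simp) hn ⟨_, REL1⟩ ⟨P, REL2a, REL2b⟩

/-- **Soundness of the TIER 2u certificate `sig12uCheck`, residue form.** [cite: CremonaAlgorithms1997, §3.6] -/
theorem sig12uCheck_sound_mod {q : ℕ} (hq : q.Prime) {a b c : ℤ} {z : ℤ × ℤ × ℤ} {t₁ t₂ : ℤ} {N : ℕ} {ε : ℤ}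
    (h : sig12uCheck q a b c z t₁ t₂ N ε = true) (v : ℤ × ℤ × ℤ × ℤ)
    (hprim : ¬ ((q : ℤ) ∣ v.1 ∧ (q : ℤ) ∣ v.2.1 ∧ (q : ℤ) ∣ v.2.2.1 ∧ (q : ℤ) ∣ v.2.2.2))
    (h0 : (q : ℤ) ^ N ∣ (killQ a b c z t₁ t₂ v).1 ∧ (q : ℤ) ^ N ∣ (killQ a b c z t₁ t₂ v).2) : False :=
  sig12uCore_sound_mod hq h rfl rfl rfl rfl rfl rfl rfl rfl v hprim h0

end Summit.BirchSwinnertonDyer.BirchSwinnertonDyer.Theorems.ShaPrimaryTransferSelmerCubicKill
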